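import Literature.AlgebraicGeometry.HodgeTheory.HypersurfaceLefschetzUpper
import HarnessLib

/-!
# Route FiniteTreeOfFlavours — crux `RigidQbarClassesAlgebraic` (stmt-HodgeConjecture-1495), line `birth`: stub `stub_offMiddleDegrees`

The registered STUB 1 of `Cruxes/RigidQbarClassesAlgebraic/Lines/birth.lean`, signature verbatim: off
the middle degree (`2k ≠ n`) a smooth hypersurface `X ⊂ ℙⁿ⁺¹_ℂ` has `algebraicClasses X k = ⊤`
(every class of `H²ᵏ(X(ℂ); ℂ)` is algebraic: `ℂ · hᵏ` for `0 < k < n`, Voisin II Cor. 1.24–1.25;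
`k = 0`, `k ≥ n` trivial). The skeleton typed it as "LITERALLY the consumer form `forall_of_two_mul_ne`
of the tree's named fact `Voisin2003_smoothHypersurface_algebraicClasses_eq_top`", whose discharge was
then in progress; the fact is now a THEOREM of the tree
(`Voisin2003_smoothHypersurface_algebraicClasses_eq_top_holds`, `HodgeTheory/HypersurfaceLefschetzUpper`),
so the stub is that consumer form applied to it. Sibling: `Theorems.stub_offMiddle` (membership form,
crux `MovableClassesAlgebraic`, `FiniteTreeOfFlavoursMovableClassesAlgebraicOffMiddle`).

No definition, no named fact, no `sorry`.

## References

* [VoisinHodgeII2003] C. Voisin, Hodge Theory and Complex Algebraic Geometry II (2003), §1.2.2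
  Thm. 1.23, §1.2.3 Cor. 1.24–1.25.
-/

noncomputable section

set_option linter.dupNamespace false

namespace Summit.HodgeConjecture.HodgeConjecture.Theorems

open CategoryTheory AlgebraicGeometry
open Literature.AlgebraicGeometry Literature.AlgebraicGeometry.Motives
open Literature.AlgebraicGeometry.HodgeTheory
open Literature.AlgebraicTopology.SingularHomology

/-- **Registered stub `stub_offMiddleDegrees` of the line `birth`** (crux `RigidQbarClassesAlgebraic`,
stmt-HodgeConjecture-1495): for a smooth hypersurface `X ⊂ ℙⁿ⁺¹_ℂ` of dimension `n` and degree `d` and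
every `k` with `2k ≠ n`, `algebraicClasses X k = ⊤` — the consumer form
`Voisin2003_smoothHypersurface_algebraicClasses_eq_top.forall_of_two_mul_ne` of the DISCHARGED Lefschetz
fact `Voisin2003_smoothHypersurface_algebraicClasses_eq_top_holds` (Lefschetz hyperplane theorem with
`ℂ`-coefficients for `V₊(F)` below the middle, hard Lefschetz above; `k = 0`, `k ≥ n` by
`algebraicClasses_zero`, classes of points, `H²ᵏ = 0`).
[cite: VoisinHodgeII2003, §1.2.2 Thm. 1.23 and §1.2.3 Cor. 1.24–1.25] -/
theorem stub_offMiddleDegrees :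
    ∀ ⦃n d : ℕ⦄ ⦃X : SchemeOver ℂ⦄, IsSmoothHypersurface n d X →
      ∀ k : ℕ, 2 * k ≠ n → algebraicClasses X k = ⊤ :=
  Voisin2003_smoothHypersurface_algebraicClasses_eq_top_holds.forall_of_two_mul_ne

end Summit.HodgeConjecture.HodgeConjecture.Theorems

end
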